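import Summits.HodgeConjecture.HodgeConjecture.Theses.EightfoldBlochSeeds
import Literature.AlgebraicGeometry.HodgeTheory.WeilFamilyLevelStructureOfPeriodConstructionAtWeilType
import Literature.AlgebraicGeometry.HodgeTheory.WeilFamilyPeriodConstructionAtWeilType
import HarnessLib

/-!
# Route `EightfoldBlochSeeds`, crux `ReachHyperbolic` (item stmt-HodgeConjecture-18883) — CONDITIONAL on exactly ONE named,
# printed, unproved Literature fact: Deligne's period construction at Weil-type points
# `deligne1982_weilFamily_periodConstructionAtWeilType` («(J1)»)

HONEST FRAMING. A CONDITIONAL RESULT: `ReachHyperbolic` (`= weilFamilyReach_hyperbolic`, Deligne 1982 proof of Thm. 4.8 with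
Cor. 4.2 — REFEREED NAMED FACT typed as an open tree item) is proved here ONLY under the hypothesis
`Literature.AlgebraicGeometry.HodgeTheory.deligne1982_weilFamily_periodConstructionAtWeilType` — Deligne's level-`n'` algebraic
family `Γ∖B → Γ∖X⁺` through every polarised complex abelian `2n`-fold OF WEIL TYPE `(n, n)` with global `√-d`, abelian fibre
charts, integral level structure, period surjectivity onto `X⁺` and one polarisation class ([Deligne1982HodgeCycles] proof of
Thm. 4.8; [vanGeemen1994HodgeAV] 5.3–5.11; [MumfordFogartyKirwan1994] Thm. 7.9–7.10), typed in
`Literature/AlgebraicGeometry/HodgeTheory/WeilFamilyPeriodConstructionAtWeilType.lean` and UNPROVED in the tree (no moduli of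
abelian varieties, no universal family, no Baily–Borel). The item stays OPEN; nothing here proves rung H2, HC_AV or HC. No
definition, no new named fact (D-0026). Census-neutral.

WHAT IS HERE (leafhand `leafhand-hodge-eightfoldblochseed-1-g0`). The line `moduli-riemann`
(`Cruxes/ReachHyperbolic/Lines/moduli_riemann.lean` 1ba65e5152037605) cuts the crux into `stub_moduliComplete` (algebraic: fine
PEL moduli, complete for realisable periods) and `stub_riemannRealisable` (transcendental: Riemann's existence theorem at Weil
type), glued by `periodPackage_of` into the period-surjective package. The tree ALREADY holds, as Literature theorems:
(i) the reduction of `weilFamilyReach_hyperbolic` to Deligne's period-construction package asked AT WEIL-TYPE POINTS ONLY, with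
Riemann's theorem [F] (fullness of `H¹_B`) DISCHARGED (`weilFamilies_of_periodConstructionAtWeilType_only`, second conjunct;
`hodgeIso_bettiOne_isogeny`), and (ii) that package as ONE named fact (J1) whose body is token-for-token the reduction's
hypothesis (its `HeckePrymWeil` consumer `Theorems.deligneWeilFamily_of_deligne1982_weilFamily_periodConstructionAtWeilType`
closes by `exact`). Hence:

* `reachHyperbolic_of_deligne1982_weilFamily_periodConstructionAtWeilType` — **(J1) ⟹ `Theses.EightfoldBlochSeeds.ReachHyperbolic`
  BY NAME**, one line. So item 18883 is CONDITIONAL on exactly one EXISTING named Literature fact; the skeleton's two stubs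
  are a finer cut of that same fact (its clause (5U) = `stub_moduliComplete`'s completeness ∘ `stub_riemannRealisable`), and
  — correcting the line card's «tree has only the converse `hodgeIso_bettiOne_isogeny`» — Riemann's existence theorem in
  Deligne–Milne's form IS a tree theorem (`DeligneMilne1982_Thm_6_20_essImage_holds`, `…_full_holds`; polarised tori are
  abelian varieties: `AbelianVarieties.exists_abelianVariety_of_isAbelianVariety`), so `stub_riemannRealisable` is an ASSEMBLY
  debt (essential image + fullness + faithfulness + an `α`-stable integral model, cf. the tree's `exists_principalModel`, Shimura §7.1
  Prop. 7, as used in `ComplexMultiplication.cmAbelianVarietyRealised_of_riemann`), not missing mathematics; what is genuinely absent is (J1)'s universal family.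
* `weilFamilyReach_hyperbolic_of_deligne1982_weilFamily_periodConstructionAtWeilType` — the same with the Literature name as
  conclusion (for consumers that take `weilFamilyReach_hyperbolic` by name, e.g. `EightfoldBlochSeeds.closes`' binder `hF`).

## References

[cite: Deligne1982HodgeCycles, §4 Prop. 4.4, Cor. 4.2 and proof of Thm. 4.8 (LNM 900 §4; Milne's TeXed ed. pp. 32–34)]
[cite: vanGeemen1994HodgeAV, 4.9, Lemma 5.2, 5.3–5.11] [cite: MumfordFogartyKirwan1994, Thm. 7.9–7.10]
[cite: DeligneMilne1982Tannakian, art. II §6 Thm. 6.20]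
-/

noncomputable section

-- single-problem summit (Problem = Summit): the mandated namespace repeats `HodgeConjecture`.
set_option linter.dupNamespace false

open CategoryTheory AlgebraicGeometry
open Literature.AlgebraicGeometry Literature.AlgebraicGeometry.Motives Literature.AlgebraicGeometry.HodgeTheory
open Literature.AlgebraicTopology.SingularHomology

namespace Summit.HodgeConjecture.HodgeConjecture.Theorems

/-- **Deligne's hyperbolic reach from the period construction at Weil-type points, by name**: the named fact (J1)
`deligne1982_weilFamily_periodConstructionAtWeilType` implies `weilFamilyReach_hyperbolic` — the second conjunct of the tree's
`weilFamilies_of_periodConstructionAtWeilType_only` (reach at hyperbolic points, which are of Weil type by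
`isWeilType_of_isHyperbolicWeilType`; Riemann's theorem [F] discharged by `hodgeIso_bettiOne_isogeny`). CONDITIONAL on (J1),
which is UNPROVED in the tree. [cite: Deligne1982HodgeCycles, §4 Cor. 4.2, Prop. 4.4 and proof of Thm. 4.8]
[cite: vanGeemen1994HodgeAV, Lemma 5.2 (4), 5.3–5.11] -/
theorem weilFamilyReach_hyperbolic_of_deligne1982_weilFamily_periodConstructionAtWeilType
    (hJ1 : deligne1982_weilFamily_periodConstructionAtWeilType) : weilFamilyReach_hyperbolic :=
  (weilFamilies_of_periodConstructionAtWeilType_only hJ1).2.1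

/-- **`ReachHyperbolic` (item stmt-HodgeConjecture-18883) CONDITIONALLY on the ONE named fact (J1)
`deligne1982_weilFamily_periodConstructionAtWeilType`** — by name, one line; the item is thereby conditional on exactly one
existing, printed, unproved Literature fact (Deligne's level-`n'` Weil family with period surjectivity; the universal PEL
family is what the tree does not construct). [cite: Deligne1982HodgeCycles, proof of Thm. 4.8 (pp. 47–52)]
[cite: MumfordFogartyKirwan1994, Thm. 7.9–7.10] -/
theorem reachHyperbolic_of_deligne1982_weilFamily_periodConstructionAtWeilType
    (hJ1 : deligne1982_weilFamily_periodConstructionAtWeilType) :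
    Summit.HodgeConjecture.HodgeConjecture.Theses.EightfoldBlochSeeds.ReachHyperbolic :=
  weilFamilyReach_hyperbolic_of_deligne1982_weilFamily_periodConstructionAtWeilType hJ1

end Summit.HodgeConjecture.HodgeConjecture.Theorems

end
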